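import Summits.KontsevichZagierPeriods.KontsevichZagierPeriods.Theorems.HurwitzMicroSectorsNormalFormPrincipleQuadKit
import Summits.KontsevichZagierPeriods.KontsevichZagierPeriods.Theorems.HurwitzMicroSectorsNormalFormPrincipleSiegeNfAPoleOneK3
import Summits.KontsevichZagierPeriods.KontsevichZagierPeriods.Theorems.HermiteRigidityGenusTwoCycleTransferPushforwardDimOne

/-!
# `NormalFormPrinciple` (stmt-KontsevichZagierPeriods-3869), line `SketchIdeator1` —
# the leaf `stub_boxRigidity` in dimension one — the simple quadratic pole: logarithmic and arctangent parts

Pure proof file (lead seat c3; `--supports` the crux). The simple quadratic pole splits as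
`(Ax+B)/((x−u)²+v²) = A(x−u)/((x−u)²+v²) + (B+Au)/((x−u)²+v²)`. The logarithmic part is moved onto a
dlog representation by the non-linear change of variables `y = (x−u)² + v²` (route constructor
`stub_pushforwardDimOne`, inverse `u + √(y − v²)`) to the right of `u` (`quad_log_right_sub_mem_relations`)
and by a reflection to the left of `u`; the arctangent part is moved onto `[·, (c/v)/(1+y²)]` by the
affine substitution `y = (x−u)/v` (`quad_ang_sub_mem_relations`, `…SiegeNfAPoleOneK3.affineA_sub_mem_relations`).

Sources: M. Kontsevich, D. Zagier, *Periods* (2001), §1.2 rule (2). No definitions are introduced.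
-/

noncomputable section

open MeasureTheory Set Finset
open scoped Polynomial
open Literature.NumberTheory.Transcendental Literature.NumberTheory.Transcendental.KZ
open Literature.ModelTheory.ExponentialFields (IsSemialgebraic isSemialgebraic_univ)

namespace Summit.KontsevichZagierPeriods.HurwitzMicroSectors.NormalFormPrinciple.PiBox

namespace Dlog

open Summit.KontsevichZagierPeriods.HermiteRigidity.GenusTwoCycleTransfer (stub_pushforwardDimOne)

/-! ## The logarithmic part of a simple quadratic pole: `A(x−u)/((x−u)²+v²)` -/

/-- **Change of variables `y = (x−u)² + v²` to the right of `u`** (rule 2, non-linear, via the route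
constructor `stub_pushforwardDimOne`): for algebraic `u ≤ a ≤ b`, `v > 0`,
`[(a,b), A(x−u)/((x−u)²+v²)] − [((a−u)²+v², (b−u)²+v²), (A/2)/y] ∈ relations`.
[cite: KontsevichZagier2001, §1.2 rule (2)] -/
theorem quad_log_right_sub_mem_relations {a b A u v : ℝ} (ha : IsAlgebraic ℚ a) (hb : IsAlgebraic ℚ b)
    (hu : IsAlgebraic ℚ u) (hv : IsAlgebraic ℚ v) (hv0 : 0 < v) (hua : u ≤ a) (hab : a ≤ b)
    (N L : IntegralRep 1) (hNd : N.domain = {x | x 0 ∈ Set.Ioo a b})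
    (hNi : EqOn N.integrand (fun x => A * (x 0 - u) / ((x 0 - u) ^ 2 + v ^ 2)) N.domain)
    (hLd : L.domain = {x | x 0 ∈ Set.Ioo ((a - u) ^ 2 + v ^ 2) ((b - u) ^ 2 + v ^ 2)})
    (hLi : EqOn L.integrand (fun x => (A / 2) / x 0) L.domain) : of N - of L ∈ relations := by
  set φ : ℝ → ℝ := fun y => (y - u) ^ 2 + v ^ 2 with hφ
  set φ' : ℝ → ℝ := fun y => 2 * (y - u) with hφ'
  set G : (Fin 1 → ℝ) → (Fin 1 → ℝ) := fun w => fun _ => u + Real.sqrt (w 0 - v ^ 2) with hG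
  set uK : algebraicClosure ℚ ℝ := ⟨u, mem_algebraicClosure_iff.mpr hu⟩
  set vK : algebraicClosure ℚ ℝ := ⟨v, mem_algebraicClosure_iff.mpr hv⟩
  have hdomsa : IsSemialgebraic ℚ N.domain := N.isSemialgebraic_domain
  have hposI : ∀ p ∈ N.domain, 0 < p 0 - u := by
    intro p hp; rw [hNd] at hp; linarith [hp.1]
  -- semialgebraicity of `φ`, `φ'`
  have hφsa : IsSemialgebraicFunOn ℚ N.domain (fun p => φ (p 0)) := by
    refine (AlgSplitK5.isSemialgebraicFunOn_aevalK hdomsa ((Polynomial.X - Polynomial.C uK) ^ 2 +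
      Polynomial.C (vK ^ 2))).congr fun x _ => ?_
    show (Polynomial.aeval (x 0) ((Polynomial.X - Polynomial.C uK) ^ 2 + Polynomial.C (vK ^ 2) :
      (algebraicClosure ℚ ℝ)[X]) : ℝ) = (x 0 - u) ^ 2 + v ^ 2
    simp only [map_add, map_pow, map_sub, Polynomial.aeval_X, Polynomial.aeval_C]
    rfl
  have hφ'sa : IsSemialgebraicFunOn ℚ N.domain (fun p => φ' (p 0)) := by
    refine (isSemialgebraicFunOn_quad hdomsa (isAlgebraic_nat (R := ℚ) 2) isAlgebraic_zero hu hv hv0.ne'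
      0).congr fun x _ => ?_
    show ((2:ℕ) * (x 0 - u) + 0) / ((x 0 - u) ^ 2 + v ^ 2) ^ 0 = 2 * (x 0 - u)
    rw [pow_zero, div_one, add_zero, Nat.cast_ofNat]
  have hder : ∀ p ∈ N.domain, HasDerivAt φ (φ' (p 0)) (p 0) := by
    intro p _
    refine ((((hasDerivAt_id' (p 0)).sub_const u).pow 2).add_const (v ^ 2)).congr_deriv ?_
    show ((2:ℕ):ℝ) * (p 0 - u) ^ (2 - 1) * 1 = 2 * (p 0 - u)
    norm_num
  have hne : ∀ p ∈ N.domain, φ' (p 0) ≠ 0 := by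
    intro p hp; simp only [hφ']; linarith [hposI p hp]
  -- the image and the inverse
  have himg : (fun p : Fin 1 → ℝ => fun _ : Fin 1 => φ (p 0)) '' N.domain =
      {x | x 0 ∈ Set.Ioo ((a - u) ^ 2 + v ^ 2) ((b - u) ^ 2 + v ^ 2)} := by
    rw [hNd]
    ext w
    simp only [Set.mem_image, Set.mem_setOf_eq, Set.mem_Ioo]
    constructor
    · rintro ⟨p, ⟨h1, h2⟩, rfl⟩
      show (a - u) ^ 2 + v ^ 2 < (p 0 - u) ^ 2 + v ^ 2 ∧ (p 0 - u) ^ 2 + v ^ 2 < (b - u) ^ 2 + v ^ 2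
      constructor <;> nlinarith
    · rintro ⟨h1, h2⟩
      have hw0 : 0 ≤ w 0 - v ^ 2 := by nlinarith [sq_nonneg (a - u)]
      have hsq : Real.sqrt (w 0 - v ^ 2) ^ 2 = w 0 - v ^ 2 := Real.sq_sqrt hw0
      have hya : a - u < Real.sqrt (w 0 - v ^ 2) := (Real.lt_sqrt (by linarith)).mpr (by linarith)
      have hbu : 0 < b - u := by nlinarith [sq_nonneg (a - u)]
      have hyb : Real.sqrt (w 0 - v ^ 2) < b - u := (Real.sqrt_lt' hbu).mpr (by linarith)
      refine ⟨fun _ => u + Real.sqrt (w 0 - v ^ 2), ⟨by linarith, by linarith⟩, ?_⟩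
      funext i
      show (u + Real.sqrt (w 0 - v ^ 2) - u) ^ 2 + v ^ 2 = w i
      rw [Fin.fin_one_eq_zero i, add_sub_cancel_left, hsq]
      ring
  have hGφ : ∀ p ∈ N.domain, G (fun _ => φ (p 0)) = p := by
    intro p hp
    funext i
    rw [Fin.fin_one_eq_zero i]
    show u + Real.sqrt ((p 0 - u) ^ 2 + v ^ 2 - v ^ 2) = p 0
    rw [add_sub_cancel_right, Real.sqrt_sq (hposI p hp).le]
    ring
  have himgsa : IsSemialgebraic ℚ ((fun p : Fin 1 → ℝ => fun _ : Fin 1 => φ (p 0)) '' N.domain) := by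
    rw [himg]
    exact isSemialgebraic_setOf_apply_mem_Ioo_of_isAlgebraic (((ha.sub hu).pow 2).add (hv.pow 2))
      (((hb.sub hu).pow 2).add (hv.pow 2)) 0
  have hG : IsSemialgebraicMapOn ℚ ((fun p : Fin 1 → ℝ => fun _ : Fin 1 => φ (p 0)) '' N.domain) G := by
    refine IsSemialgebraicMapOn.of_forall himgsa fun j => ?_
    have hlin : IsSemialgebraicFunOn ℚ ((fun p : Fin 1 → ℝ => fun _ : Fin 1 => φ (p 0)) '' N.domain)
        (fun w => w 0 - v ^ 2) := by
      refine (AlgSplitK5.isSemialgebraicFunOn_aevalK himgsa (Polynomial.X - Polynomial.C (vK ^ 2))).congr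
        fun x _ => ?_
      show (Polynomial.aeval (x 0) (Polynomial.X - Polynomial.C (vK ^ 2) :
        (algebraicClosure ℚ ℝ)[X]) : ℝ) = x 0 - v ^ 2
      simp only [map_sub, map_pow, Polynomial.aeval_X, Polynomial.aeval_C]
      rfl
    exact IsSemialgebraicFunOn.add_holds (isSemialgebraicFunOn_const_of_isAlgebraic himgsa hu)
      (IsSemialgebraicFunOn.sqrt_holds hlin)
  -- push forward and compare with `L`
  obtain ⟨s, hsd, hsi, hmove⟩ := stub_pushforwardDimOne N φ φ' G hφsa hφ'sa hder hne hG hGφ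
  have h2 : of s - of L ∈ relations := by
    refine of_sub_of_mem_relations_of_eqOn (by rw [hLd, hsd, himg]) ?_
    intro z hz
    rw [hsd] at hz
    obtain ⟨p, hp, rfl⟩ := hz
    rw [hsi p hp, hNi hp, hLi (by rw [hLd, ← himg]; exact Set.mem_image_of_mem _ hp)]
    have h0 := hposI p hp
    show A * (p 0 - u) / ((p 0 - u) ^ 2 + v ^ 2) / |2 * (p 0 - u)| = (A / 2) / ((p 0 - u) ^ 2 + v ^ 2)
    rw [abs_of_pos (by linarith)]
    have hQ := (quad_pos (u := u) hv0.ne' (p 0)).ne'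
    rw [div_div, div_eq_div_iff (mul_ne_zero hQ (by linarith)) hQ]
    ring
  have : of N - of L = (of N - of s) + (of s - of L) := by abel
  rw [this]
  exact relations.add_mem (changeOfVariablesRel_subset_relations hmove) h2

/-- **The logarithmic part to the left of `u`**: for algebraic `a ≤ b ≤ u`, `v > 0`,
`[(a,b), A(x−u)/((x−u)²+v²)] − [((b−u)²+v², (a−u)²+v²), (−A/2)/y] ∈ relations` (reflect `x ↦ −x`,
then `quad_log_right_sub_mem_relations`). [cite: KontsevichZagier2001, §1.2 rule (2)] -/
theorem quad_log_left_sub_mem_relations {a b A u v : ℝ} (ha : IsAlgebraic ℚ a) (hb : IsAlgebraic ℚ b)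
    (hA : IsAlgebraic ℚ A) (hu : IsAlgebraic ℚ u) (hv : IsAlgebraic ℚ v) (hv0 : 0 < v) (hbu : b ≤ u)
    (hab : a ≤ b) (N L : IntegralRep 1) (hNd : N.domain = {x | x 0 ∈ Set.Ioo a b})
    (hNi : EqOn N.integrand (fun x => A * (x 0 - u) / ((x 0 - u) ^ 2 + v ^ 2)) N.domain)
    (hLd : L.domain = {x | x 0 ∈ Set.Ioo ((b - u) ^ 2 + v ^ 2) ((a - u) ^ 2 + v ^ 2)})
    (hLi : EqOn L.integrand (fun x => (-A / 2) / x 0) L.domain) : of N - of L ∈ relations := by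
  -- the reflected representation
  obtain ⟨N', hN'd, hN'i⟩ := exists_quadRep (a := -b) (b := -a) (A := -A) (B := 0) (u := -u)
    hb.neg ha.neg hA.neg isAlgebraic_zero hu.neg hv hv0.ne' 1
  have hN'i' : EqOn N'.integrand (fun x => -A * (x 0 - -u) / ((x 0 - -u) ^ 2 + v ^ 2)) N'.domain := by
    intro x _; rw [hN'i]; simp only [add_zero, pow_one]
  have h1 : of N - of N' ∈ relations := by
    refine SiegeK3.affineA_sub_mem_relations (s := -1) (t := 0) isAlgebraic_one.neg isAlgebraic_zero (by norm_num)
      N N' (fun y => -A * (y - -u) / ((y - -u) ^ 2 + v ^ 2)) ?_ hN'i' fun x hx => ?_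
    · rw [hN'd, hNd, image_affine_slab_of_neg (by norm_num : (-1:ℝ) < 0)]
      simp only [neg_one_mul, add_zero]
    · rw [hNi hx]
      have hQ := (quad_pos (u := u) hv0.ne' (x 0)).ne'
      have hQ' : (-1 * x 0 + 0 - -u) ^ 2 + v ^ 2 ≠ 0 := (quad_pos (u := -u) hv0.ne' _).ne'
      show A * (x 0 - u) / ((x 0 - u) ^ 2 + v ^ 2) =
        -A * (-1 * x 0 + 0 - -u) / ((-1 * x 0 + 0 - -u) ^ 2 + v ^ 2) * |(-1:ℝ)|
      rw [abs_neg, abs_one, mul_one, div_eq_div_iff hQ hQ']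
      ring
  have h2 : of N' - of L ∈ relations := by
    refine quad_log_right_sub_mem_relations hb.neg ha.neg hu.neg hv hv0 (by linarith) (by linarith)
      N' L hN'd hN'i' ?_ hLi
    rw [show (-b - -u) ^ 2 + v ^ 2 = (b - u) ^ 2 + v ^ 2 by ring,
      show (-a - -u) ^ 2 + v ^ 2 = (a - u) ^ 2 + v ^ 2 by ring]
    exact hLd
  have : of N - of L = (of N - of N') + (of N' - of L) := by abel
  rw [this]
  exact relations.add_mem h1 h2

/-! ## The arctangent part of a simple quadratic pole: `c/((x−u)²+v²)` -/

/-- **The affine substitution `y = (x−u)/v`** (rule 2): for algebraic `u`, `v > 0`,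
`[(a,b), c/((x−u)²+v²)] − [((a−u)/v, (b−u)/v), (c/v)/(1+y²)] ∈ relations`.
[cite: KontsevichZagier2001, §1.2 rule (2)] -/
theorem quad_ang_sub_mem_relations {a b c u v : ℝ} (hu : IsAlgebraic ℚ u) (hv : IsAlgebraic ℚ v)
    (hv0 : 0 < v) (N L : IntegralRep 1) (hNd : N.domain = {x | x 0 ∈ Set.Ioo a b})
    (hNi : EqOn N.integrand (fun x => c / ((x 0 - u) ^ 2 + v ^ 2)) N.domain)
    (hLd : L.domain = {x | x 0 ∈ Set.Ioo ((a - u) / v) ((b - u) / v)})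
    (hLi : EqOn L.integrand (fun x => (c / v) / (1 + x 0 ^ 2)) L.domain) : of N - of L ∈ relations := by
  have hv0' : v ≠ 0 := hv0.ne'
  have htA : IsAlgebraic ℚ (-u / v) := by rw [div_eq_mul_inv]; exact hu.neg.mul hv.inv
  refine SiegeK3.affineA_sub_mem_relations (s := v⁻¹) (t := -u / v) hv.inv htA (inv_ne_zero hv0') N L
    (fun y => (c / v) / (1 + y ^ 2)) ?_ hLi fun x hx => ?_
  · rw [hLd, hNd, image_affine_slab_of_pos (inv_pos.mpr hv0)]
    rw [show v⁻¹ * a + -u / v = (a - u) / v by rw [inv_mul_eq_div, neg_div, ← sub_eq_add_neg, sub_div],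
      show v⁻¹ * b + -u / v = (b - u) / v by rw [inv_mul_eq_div, neg_div, ← sub_eq_add_neg, sub_div]]
  · rw [hNi hx]
    have hQ := (quad_pos (u := u) hv0' (x 0)).ne'
    show c / ((x 0 - u) ^ 2 + v ^ 2) = (c / v) / (1 + (v⁻¹ * x 0 + -u / v) ^ 2) * |v⁻¹|
    rw [abs_of_pos (inv_pos.mpr hv0),
      show v⁻¹ * x 0 + -u / v = (x 0 - u) / v by rw [inv_mul_eq_div, neg_div, ← sub_eq_add_neg, sub_div],
      div_pow, one_add_div (pow_ne_zero 2 hv0'), div_div_eq_mul_div, div_eq_iff hQ]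
    field_simp
    ring

end Dlog

end Summit.KontsevichZagierPeriods.HurwitzMicroSectors.NormalFormPrinciple.PiBox
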